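/-
Copyright (c) 2026 the pub-hodgecm-mathlib formalisation cell (harness21).  Prover seat hodgecm-mathlib-K2Liu-p12 (g0): Track B «K2-LIT»,
#184♮ = hLiu418 = stmt-HodgeConjecture-24832; Road Φ of socket #41, organ Φ5 «bad finite places» (LEAD F0P6-plan (g12) CAP-1 deal, REQUESTS l.72710).
-/
import Literature.NumberTheory.Automorphic.TateLocalZetaShells      -- ★ `primePowBall`, `AddChar.HasConductorExp`, `setIntegral_primePowBall_addChar_mul`
import Mathlib.MeasureTheory.Integral.Prod
import Mathlib.MeasureTheory.Group.Integral
import Mathlib.MeasureTheory.Measure.Haar.MulEquivHaarChar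
import HarnessLib

/-!
# Crux `HLiu418`, Road Φ of socket #41, organ Φ5 — FILE F1: VANISHING OF OSCILLATORY INTEGRALS BY AVERAGING (Karel's lemma, abstract core)

Cell `hodgecm-mathlib`, crux item hLiu418 = `stmt-HodgeConjecture-24832`, route of record `HCCMUnconditional`; squad K2 ∕ K2Liu, road `K2_Liu`,
socket #41 `sig_K2LiuSiegelEisensteinContinuation`, Road Φ (ruling «M-155l»), organ Φ5 «at a bad finite place `v`, for a `K_v`-finite Siegel section
`f_v` and `det β ≠ 0`, `s ↦ W_{β,v}(f_v,s)` is ENTIRE, bounded on compacta polynomially in `β`, and vanishes for `β` off an `f_v`-lattice»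
(census `K2/K2Liu-p12/g0/CENSUS-PHI5-BadPlaceWhittaker.K2Liu-p12-g0.md` §3, file F1).  THEOREMS ONLY (no `def`, no `instance`, no `notation`, no named-fact
hypothesis, no `sorry`); lane `--supports stmt-HodgeConjecture-24832` (count-neutral helper; closes no socket by itself).

THE MATHEMATICS.  The local Whittaker coefficient `W_β(f) = ∫_{N(F_v)} f(w n(X)) ψ̄_β(X) dX` of a smooth section is not absolutely convergent
for small `Re s`; Karel's lemma says the integrals over the shells `S_k = ϖ^{−k}Λ ∖ ϖ^{−k+1}Λ` VANISH for `k ≥ k₀(β, f)`, so that `W_β(f)` is the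
integral over one compact ball and is entire in `s`.  This file isolates the two measure-theoretic engines, free of any group-theoretic carrier:

* §1 **one translation** (`setIntegral_eq_zero_of_translate`): on an additive group with a right-invariant measure, if `S + t = S`, and
  `g(x + t) = ζ·g(x)` on `S` with a constant `ζ ≠ 1`, then `∫_S g = 0` (`I = ζ I`).  This gives the lattice-support clause of Φ5
  (`t ∈ ϖ^mΛ` with `ψ_β(t) ≠ 1`) and is Tate's computation of `𝟙̂_{𝔭^n}` in the abstract.
* §2 **averaging over a family of moves** (`setIntegral_inter_eq_setIntegral_inter_box`, `setIntegral_eq_setIntegral_inter_boxes`,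
  `setIntegral_eq_zero_of_averaging`): `F` a non-archimedean local field, `ψ` an additive character of conductor exponent `d`,
  `(V, μ)` any measure space, `S ⊆ V` of finite measure, `g : V → ℂ` bounded measurable, and finitely many «moves» `L i z : V → V`
  (`z ∈ 𝔭^j`) with «coefficients» `c i : V → F` such that on `S`: (h1) `∫_S g' ∘ L i z = ∫_S g'` for every `g'` (measure preservation +
  `L i z` permutes `S`), (h2) `g(L i z x) = g(x)·ψ(z·c i x)`, (h3) the boxes `{c i ∈ 𝔭^{d−j}}` are permuted by every move.  Averaging `z` over `𝔭^j`
  (Fubini on a product of finite measures) and ★ orthogonality `∫_{𝔭^j} ψ(z y) dz = μ(𝔭^j)·𝟙[y ∈ 𝔭^{d−j}]` (`TateLocalZetaShells.setIntegral_primePowBall_addChar_mul`)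
  cut `∫_S g` down to `∫_{S ∩ ⋂_i {c i ∈ 𝔭^{d−j}}} g`; if the boxes do not cover any point of `S` (h4: `∀ x ∈ S, ∃ i, c i x ∉ 𝔭^{d−j}`) then `∫_S g = 0`.
  In Φ5: `V = N_Δ(F_v) ≅ Herm_n`, `g = (f_s ∘ w_Δ n)·ψ̄_β`, `S = S_k`, the moves are the LEVI moves `X ↦ X + z(uX + Xu⋆)` (`A = 1 + zu`, `f_s(w n(AXA⋆)) = f_s(w n(X))`),
  `c u X = Tr tr(Xβu)`, and (h4) is `det β ≠ 0` (files F3–F4 of the census).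
* §3 **lattice automorphisms preserve Haar measure** (`map_eq_self_of_preimage_eq`, `setIntegral_comp_eq_of_preimage_eq`): a bi-continuous additive
  automorphism `e` of a locally compact abelian group with `e⁻¹(Λ) = Λ` for one set `Λ` of finite positive measure has `addEquivAddHaarChar e = 1`, hence is
  measure-preserving, hence satisfies (h1) on every `S` with `e⁻¹(S) = S` (Mathlib `addEquivAddHaarChar_smul_preimage`, `addEquivAddHaarChar_smul_map`).

## References
* [Casselman1980] W. Casselman, *The unramified principal series of p-adic groups I*, Compositio Math. 40 (1980), §3 (holomorphy of the Jacquet∕Whittaker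
  integral: the integrals over large pieces of `N` vanish against a non-degenerate character).
* [Tate1950] J. Tate, *Fourier analysis in number fields and Hecke's zeta-functions* (1950), §2.5 (orthogonality on `𝔭^n`), in Cassels–Fröhlich Ch. XV.
* [KudlaRallis1994] S. Kudla, S. Rallis, Ann. of Math. 140 (1994), §2 (Fourier coefficients of Siegel Eisenstein series, local Whittaker functionals).
* [Shimura1997] G. Shimura, *Euler products and Eisenstein series*, CBMS 93 (1997), §18 (local coefficients at bad places are entire).
-/

set_option autoImplicit false
-- the mandated namespace repeats the single-problem summit's segment (`HodgeConjecture.HodgeConjecture`)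
set_option linter.dupNamespace false

noncomputable section

open scoped NNReal ENNReal
open MeasureTheory Set Filter Function
open Literature.NumberTheory.Automorphic

namespace Summit.HodgeConjecture.HodgeConjecture.Cruxes.HLiu418.K2LiuShellVanishingByAveraging

/-! ## §1 One translation -/

/-- **Vanishing by one translation** (Tate's `𝟙̂_{𝔭^n}` argument in the abstract): on an additive group with a right-invariant measure, if the
measurable set `S` is stable under `x ↦ x + t` and `g(x + t) = ζ·g(x)` on `S` for a constant `ζ ≠ 1`, then `∫_S g dμ = 0` — the substitution
`x ↦ x + t` gives `I = ζ·I`.  (No integrability hypothesis: a non-integrable `g` has Bochner integral `0` on both sides.)  Φ5 uses it with `t` in the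
invariance lattice `ϖ^mΛ` of the section and `ζ = ψ̄_β(t) ≠ 1`: the Whittaker coefficient vanishes for `β` off the dual lattice.
[cite: Tate1950, §2.5] [cite: Casselman1980, §3] -/
theorem setIntegral_eq_zero_of_translate {V : Type*} [AddGroup V] [MeasurableSpace V] [MeasurableAdd V] (μ : Measure V)
    [μ.IsAddRightInvariant] {S : Set V} (hS : MeasurableSet S) {t : V} (hSt : ∀ x, x + t ∈ S ↔ x ∈ S) {g : V → ℂ} {ζ : ℂ}
    (hg : ∀ x ∈ S, g (x + t) = ζ * g x) (hζ : ζ ≠ 1) : ∫ x in S, g x ∂μ = 0 := by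
  have key : ∫ x in S, g x ∂μ = ζ * ∫ x in S, g x ∂μ := by
    rw [← integral_indicator hS, ← integral_const_mul, ← integral_add_right_eq_self _ t]
    refine integral_congr_ae (Eventually.of_forall fun x => ?_)
    change S.indicator g (x + t) = ζ * S.indicator g x
    by_cases hx : x ∈ S
    · rw [indicator_of_mem ((hSt x).2 hx), indicator_of_mem hx, hg x hx]
    · rw [indicator_of_notMem (fun h => hx ((hSt x).1 h)), indicator_of_notMem hx, mul_zero]
  have h : (1 - ζ) * ∫ x in S, g x ∂μ = 0 := by rw [sub_mul, one_mul, ← key, sub_self]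
  exact (mul_eq_zero.1 h).resolve_left (sub_ne_zero.2 hζ.symm)

/-! ## §2 Averaging over moves -/

section Averaging

variable {F : Type*} [Field F] [ValuativeRel F] [TopologicalSpace F] [IsNonarchimedeanLocalField F] [MeasurableSpace F] [BorelSpace F]
variable {V : Type*} [MeasurableSpace V]

open scoped Classical in
/-- the orthogonality relation in the order `ψ(z·y)`: `∫_{z ∈ 𝔭^j} ψ(z y) dμ_F = μ_F(𝔭^j)` if `y ∈ 𝔭^{d−j}`, else `0`. [cite: Tate1950, §2.5] -/
theorem setIntegral_primePowBall_addChar_mul_right (μF : Measure F) [μF.IsAddHaarMeasure] {ψ : AddChar F Circle} {d : ℤ}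
    (hd : ψ.HasConductorExp d) (j : ℤ) (y : F) :
    ∫ z in primePowBall F j, ((ψ (z * y) : Circle) : ℂ) ∂μF =
      if y ∈ primePowBall F (d - j) then (μF.real (primePowBall F j) : ℂ) else 0 :=
  setIntegral_primePowBall_addChar_mul μF hd j y

/-- measurability of `(z, x) ↦ ψ(z · c x)` for a continuous `ψ` and a measurable coefficient `c`. [cite: Tate1950, §2.5] -/
theorem measurable_addChar_mul_coeff {ψ : AddChar F Circle} (hψ : Continuous ψ) {c : V → F} (hc : Measurable c) :
    Measurable fun p : F × V => ((ψ (p.1 * c p.2) : Circle) : ℂ) := by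
  haveI := secondCountableTopology_localField F
  have h1 : Measurable fun p : F × V => p.1 * c p.2 := measurable_fst.mul (hc.comp measurable_snd)
  have h2 : Measurable fun x : F => ((ψ x : Circle) : ℂ) := (continuous_subtype_val.comp hψ).measurable
  exact h2.comp h1

/-- **One averaging step.**  `S, T ⊆ V` measurable, `μ S < ∞`, `g` measurable and bounded on `S`; a move `L z` (`z ∈ 𝔭^j`) with coefficient `c` such that on `S`:
`∫_S g' ∘ L z = ∫_S g'` for all `g'`, `L z` permutes `T`, and `g(L z x) = g(x)·ψ(z·c x)`.  Then `∫_{S ∩ T} g = ∫_{S ∩ T ∩ {c ∈ 𝔭^{d−j}}} g`: average the identity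
`∫_{S∩T} g = ∫_{S∩T} g·ψ(z c ·)` over `z ∈ 𝔭^j` and use orthogonality. [cite: Casselman1980, §3] [cite: Tate1950, §2.5] -/
theorem setIntegral_inter_eq_setIntegral_inter_box (μF : Measure F) [μF.IsAddHaarMeasure] {ψ : AddChar F Circle} (hψ : Continuous ψ) {d : ℤ}
    (hd : ψ.HasConductorExp d) (j : ℤ) (μ : Measure V) {S T : Set V} (hS : MeasurableSet S) (hT : MeasurableSet T) (hSμ : μ S ≠ ∞)
    {g : V → ℂ} (hgm : Measurable g) {C : ℝ} (hgC : ∀ x ∈ S, ‖g x‖ ≤ C) {L : F → V → V} {c : V → F} (hc : Measurable c)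
    (hL : ∀ z ∈ primePowBall F j, ∀ g' : V → ℂ, ∫ x in S, g' (L z x) ∂μ = ∫ x in S, g' x ∂μ)
    (hLT : ∀ z ∈ primePowBall F j, ∀ x ∈ S, L z x ∈ T ↔ x ∈ T)
    (hgL : ∀ z ∈ primePowBall F j, ∀ x ∈ S, g (L z x) = g x * ((ψ (z * c x) : Circle) : ℂ)) :
    ∫ x in S ∩ T, g x ∂μ = ∫ x in S ∩ T ∩ {x | c x ∈ primePowBall F (d - j)}, g x ∂μ := by
  classical
  haveI : IsTopologicalRing F := inferInstance
  set B : Set F := primePowBall F j with hB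
  have hBm : MeasurableSet B := measurableSet_primePowBall j
  have hBpos : 0 < μF.real B := by
    rw [measureReal_def]
    exact ENNReal.toReal_pos (addHaar_primePowBall_pos μF j).ne' (measure_primePowBall_lt_top μF j).ne
  -- step 1: twist by `ψ(z c ·)` for every `z ∈ 𝔭^j`
  have step1 : ∀ z ∈ B, ∫ x in S ∩ T, g x ∂μ = ∫ x in S ∩ T, g x * ((ψ (z * c x) : Circle) : ℂ) ∂μ := by
    intro z hz
    rw [← setIntegral_indicator hT, ← setIntegral_indicator hT, ← hL z hz (T.indicator g)]
    refine setIntegral_congr_fun hS fun x hx => ?_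
    by_cases hxT : x ∈ T
    · rw [indicator_of_mem ((hLT z hz x hx).2 hxT), indicator_of_mem hxT, hgL z hz x hx]
    · rw [indicator_of_notMem (fun h => hxT ((hLT z hz x hx).1 h)), indicator_of_notMem hxT]
  -- finiteness and integrability bookkeeping
  have hSTμ : μ (S ∩ T) ≠ ∞ := ((measure_mono inter_subset_left).trans_lt (lt_top_iff_ne_top.2 hSμ)).ne
  haveI : IsFiniteMeasure (μ.restrict (S ∩ T)) := isFiniteMeasure_restrict.2 hSTμ
  haveI : IsFiniteMeasure (μF.restrict B) := isFiniteMeasure_restrict.2 (measure_primePowBall_lt_top μF j).ne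
  have hGm : Measurable fun p : F × V => g p.2 * ((ψ (p.1 * c p.2) : Circle) : ℂ) :=
    (hgm.comp measurable_snd).mul (measurable_addChar_mul_coeff hψ hc)
  have hGint : Integrable (uncurry fun z x => g x * ((ψ (z * c x) : Circle) : ℂ)) ((μF.restrict B).prod (μ.restrict (S ∩ T))) := by
    refine Integrable.of_bound hGm.aestronglyMeasurable C ?_
    have hae : ∀ᵐ p ∂(μF.restrict B).prod (μ.restrict (S ∩ T)), p ∈ (Prod.snd ⁻¹' (S ∩ T) : Set (F × V)) := by
      refine (Measure.ae_prod_mem_iff_ae_ae_mem (measurable_snd (hS.inter hT))).2 ?_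
      exact Eventually.of_forall fun z => ae_restrict_mem (hS.inter hT)
    filter_upwards [hae] with p hp
    change ‖g p.2 * ((ψ (p.1 * c p.2) : Circle) : ℂ)‖ ≤ C
    rw [norm_mul, Circle.norm_coe, mul_one]
    exact hgC p.2 hp.1
  -- step 2: average over `z ∈ 𝔭^j`
  have step2 : (μF.real B : ℂ) * ∫ x in S ∩ T, g x ∂μ =
      ∫ x in S ∩ T, g x * (∫ z in B, ((ψ (z * c x) : Circle) : ℂ) ∂μF) ∂μ := by
    calc (μF.real B : ℂ) * ∫ x in S ∩ T, g x ∂μ = ∫ _ in B, (∫ x in S ∩ T, g x ∂μ) ∂μF := by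
          rw [setIntegral_const, Complex.real_smul]
      _ = ∫ z in B, (∫ x in S ∩ T, g x * ((ψ (z * c x) : Circle) : ℂ) ∂μ) ∂μF :=
          setIntegral_congr_fun hBm fun z hz => step1 z hz
      _ = ∫ x in S ∩ T, (∫ z in B, g x * ((ψ (z * c x) : Circle) : ℂ) ∂μF) ∂μ := integral_integral_swap hGint
      _ = ∫ x in S ∩ T, g x * (∫ z in B, ((ψ (z * c x) : Circle) : ℂ) ∂μF) ∂μ := by
          refine integral_congr_ae (Eventually.of_forall fun x => ?_)
          exact integral_const_mul (g x) _
  -- step 3: orthogonality, pointwise in `x`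
  have step3 : ∫ x in S ∩ T, g x * (∫ z in B, ((ψ (z * c x) : Circle) : ℂ) ∂μF) ∂μ =
      (μF.real B : ℂ) * ∫ x in S ∩ T ∩ {x | c x ∈ primePowBall F (d - j)}, g x ∂μ := by
    have hpt : ∀ x, g x * (∫ z in B, ((ψ (z * c x) : Circle) : ℂ) ∂μF) =
        (c ⁻¹' primePowBall F (d - j)).indicator (fun x => (μF.real B : ℂ) * g x) x := by
      intro x
      rw [setIntegral_primePowBall_addChar_mul_right μF hd j (c x)]
      by_cases hx : c x ∈ primePowBall F (d - j)
      · rw [if_pos hx, indicator_of_mem (show x ∈ c ⁻¹' primePowBall F (d - j) from hx), mul_comm]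
      · rw [if_neg hx, indicator_of_notMem (show x ∉ c ⁻¹' primePowBall F (d - j) from hx), mul_zero]
    calc ∫ x in S ∩ T, g x * (∫ z in B, ((ψ (z * c x) : Circle) : ℂ) ∂μF) ∂μ
        = ∫ x in S ∩ T, (c ⁻¹' primePowBall F (d - j)).indicator (fun x => (μF.real B : ℂ) * g x) x ∂μ :=
          integral_congr_ae (Eventually.of_forall hpt)
      _ = ∫ x in S ∩ T ∩ c ⁻¹' primePowBall F (d - j), (μF.real B : ℂ) * g x ∂μ :=
          setIntegral_indicator (hc (measurableSet_primePowBall (d - j)))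
      _ = (μF.real B : ℂ) * ∫ x in S ∩ T ∩ {x | c x ∈ primePowBall F (d - j)}, g x ∂μ := integral_const_mul _ _
  have h := step2.trans step3
  exact mul_left_cancel₀ (Complex.ofReal_ne_zero.2 hBpos.ne') h

/-- **Iterated averaging.**  With finitely many moves `L i z` (`i ∈ s`, `z ∈ 𝔭^j`) and coefficients `c i` as in `setIntegral_inter_eq_setIntegral_inter_box`, whose
boxes `{c i ∈ 𝔭^{d−j}}` are permuted by every move on `S`, the integral over `S` equals the integral over `S ∩ ⋂_{i ∈ s} {c i ∈ 𝔭^{d−j}}`.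
[cite: Casselman1980, §3] [cite: Tate1950, §2.5] -/
theorem setIntegral_eq_setIntegral_inter_boxes {ι : Type*} (s : Finset ι) (μF : Measure F) [μF.IsAddHaarMeasure] {ψ : AddChar F Circle}
    (hψ : Continuous ψ) {d : ℤ} (hd : ψ.HasConductorExp d) (j : ℤ) (μ : Measure V) {S : Set V} (hS : MeasurableSet S) (hSμ : μ S ≠ ∞)
    {g : V → ℂ} (hgm : Measurable g) {C : ℝ} (hgC : ∀ x ∈ S, ‖g x‖ ≤ C) {L : ι → F → V → V} {c : ι → V → F} (hc : ∀ i ∈ s, Measurable (c i))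
    (hL : ∀ i ∈ s, ∀ z ∈ primePowBall F j, ∀ g' : V → ℂ, ∫ x in S, g' (L i z x) ∂μ = ∫ x in S, g' x ∂μ)
    (hgL : ∀ i ∈ s, ∀ z ∈ primePowBall F j, ∀ x ∈ S, g (L i z x) = g x * ((ψ (z * c i x) : Circle) : ℂ))
    (hbox : ∀ i ∈ s, ∀ i' ∈ s, ∀ z ∈ primePowBall F j, ∀ x ∈ S,
      (c i (L i' z x) ∈ primePowBall F (d - j) ↔ c i x ∈ primePowBall F (d - j))) :
    ∫ x in S, g x ∂μ = ∫ x in S ∩ {x | ∀ i ∈ s, c i x ∈ primePowBall F (d - j)}, g x ∂μ := by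
  classical
  -- induction over sub-finsets `s' ⊆ s`
  suffices h : ∀ s' : Finset ι, s' ⊆ s →
      ∫ x in S, g x ∂μ = ∫ x in S ∩ {x | ∀ i ∈ s', c i x ∈ primePowBall F (d - j)}, g x ∂μ from h s le_rfl
  intro s'
  induction s' using Finset.induction_on with
  | empty =>
    intro _
    have : {x : V | ∀ i ∈ (∅ : Finset ι), c i x ∈ primePowBall F (d - j)} = univ :=
      eq_univ_of_forall fun x i hi => absurd hi (Finset.notMem_empty i)
    rw [this, inter_univ]
  | insert a s' ha ih =>
    intro hsub
    have has : a ∈ s := hsub (Finset.mem_insert_self a s')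
    have hs's : s' ⊆ s := fun i hi => hsub (Finset.mem_insert_of_mem hi)
    set T : Set V := {x | ∀ i ∈ s', c i x ∈ primePowBall F (d - j)} with hTdef
    have hT : MeasurableSet T := by
      have hT' : T = ⋂ i ∈ s', c i ⁻¹' primePowBall F (d - j) := by
        ext x
        simp only [hTdef, mem_setOf_eq, mem_iInter, mem_preimage]
      rw [hT']
      exact MeasurableSet.biInter s'.countable_toSet fun i hi => hc i (hs's hi) (measurableSet_primePowBall (d - j))
    have hLT : ∀ z ∈ primePowBall F j, ∀ x ∈ S, L a z x ∈ T ↔ x ∈ T := by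
      intro z hz x hx
      simp only [hTdef, mem_setOf_eq]
      exact forall₂_congr fun i hi => hbox i (hs's hi) a has z hz x hx
    have hset : S ∩ T ∩ {x | c a x ∈ primePowBall F (d - j)} = S ∩ {x | ∀ i ∈ insert a s', c i x ∈ primePowBall F (d - j)} := by
      ext x
      simp only [hTdef, mem_inter_iff, mem_setOf_eq, Finset.forall_mem_insert]
      tauto
    rw [ih hs's, setIntegral_inter_eq_setIntegral_inter_box μF hψ hd j μ hS hT hSμ hgm hgC (hc a has) (hL a has) hLT (hgL a has), hset]

/-- **Karel's vanishing principle (abstract form).**  In the situation of `setIntegral_eq_setIntegral_inter_boxes`, if for every `x ∈ S` some coefficient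
`c i x` lies OUTSIDE `𝔭^{d−j}` (in Φ5: `det β ≠ 0` forces `max_u ‖Tr tr(Xβu)‖ ≥ ‖X‖∕‖β⁻¹‖`, larger than `q^{j−d}` on far shells), then `∫_S g dμ = 0`.
[cite: Casselman1980, §3] [cite: KudlaRallis1994, §2] [cite: Shimura1997, §18] -/
theorem setIntegral_eq_zero_of_averaging {ι : Type*} (s : Finset ι) (μF : Measure F) [μF.IsAddHaarMeasure] {ψ : AddChar F Circle}
    (hψ : Continuous ψ) {d : ℤ} (hd : ψ.HasConductorExp d) (j : ℤ) (μ : Measure V) {S : Set V} (hS : MeasurableSet S) (hSμ : μ S ≠ ∞)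
    {g : V → ℂ} (hgm : Measurable g) {C : ℝ} (hgC : ∀ x ∈ S, ‖g x‖ ≤ C) {L : ι → F → V → V} {c : ι → V → F} (hc : ∀ i ∈ s, Measurable (c i))
    (hL : ∀ i ∈ s, ∀ z ∈ primePowBall F j, ∀ g' : V → ℂ, ∫ x in S, g' (L i z x) ∂μ = ∫ x in S, g' x ∂μ)
    (hgL : ∀ i ∈ s, ∀ z ∈ primePowBall F j, ∀ x ∈ S, g (L i z x) = g x * ((ψ (z * c i x) : Circle) : ℂ))
    (hbox : ∀ i ∈ s, ∀ i' ∈ s, ∀ z ∈ primePowBall F j, ∀ x ∈ S,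
      (c i (L i' z x) ∈ primePowBall F (d - j) ↔ c i x ∈ primePowBall F (d - j)))
    (hcov : ∀ x ∈ S, ∃ i ∈ s, c i x ∉ primePowBall F (d - j)) :
    ∫ x in S, g x ∂μ = 0 := by
  rw [setIntegral_eq_setIntegral_inter_boxes s μF hψ hd j μ hS hSμ hgm hgC hc hL hgL hbox]
  have hempty : S ∩ {x | ∀ i ∈ s, c i x ∈ primePowBall F (d - j)} = ∅ := by
    refine eq_empty_of_forall_notMem fun x hx => ?_
    obtain ⟨i, hi, hci⟩ := hcov x hx.1
    exact hci (hx.2 i hi)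
  rw [hempty, Measure.restrict_empty, integral_zero_measure]

end Averaging

/-! ## §3 Lattice automorphisms preserve Haar measure -/

section Lattice

variable {V : Type*} [AddCommGroup V] [TopologicalSpace V] [IsTopologicalAddGroup V] [MeasurableSpace V] [BorelSpace V]
  [LocallyCompactSpace V]

/-- **An additive bi-continuous automorphism fixing one set of finite positive measure preserves Haar measure**: if `e⁻¹(Λ) = Λ` with
`0 < μ Λ < ∞`, then `addEquivAddHaarChar e = 1` and `μ.map e = μ`.  (In Φ5: `e X = X + z(uX + Xu⋆)` is `≡ id (mod 𝔭^j)`, so it maps the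
lattice `Λ` onto itself.) [cite: Casselman1980, §3] -/
theorem map_eq_self_of_preimage_eq (μ : Measure V) [μ.IsAddHaarMeasure] [μ.Regular] (e : V ≃ₜ+ V) {Λ : Set V}
    (hΛ0 : μ Λ ≠ 0) (hΛ : μ Λ ≠ ∞) (he : e ⁻¹' Λ = Λ) : μ.map e = μ := by
  have h1 : addEquivAddHaarChar e • μ (e ⁻¹' Λ) = μ Λ := addEquivAddHaarChar_smul_preimage μ e
  rw [he] at h1
  have hc : addEquivAddHaarChar e = 1 := by
    have h2 : ((addEquivAddHaarChar e : ℝ≥0∞)) * μ Λ = 1 * μ Λ := by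
      rw [one_mul]
      simpa [ENNReal.smul_def, smul_eq_mul] using h1
    have h3 := (ENNReal.mul_left_inj hΛ0 hΛ).1 h2
    exact_mod_cast h3
  have h4 := addEquivAddHaarChar_smul_map μ e
  rwa [hc, one_smul] at h4

/-- the same, as a `MeasurePreserving` statement. [cite: Casselman1980, §3] -/
theorem measurePreserving_of_preimage_eq (μ : Measure V) [μ.IsAddHaarMeasure] [μ.Regular] (e : V ≃ₜ+ V) {Λ : Set V}
    (hΛ0 : μ Λ ≠ 0) (hΛ : μ Λ ≠ ∞) (he : e ⁻¹' Λ = Λ) : MeasurePreserving e μ μ :=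
  ⟨e.continuous.measurable, map_eq_self_of_preimage_eq μ e hΛ0 hΛ he⟩

/-- **hypothesis (h1) of §2 for lattice automorphisms**: if moreover `e⁻¹(S) = S` then `∫_S g ∘ e = ∫_S g` for every `g`.
[cite: Casselman1980, §3] -/
theorem setIntegral_comp_eq_of_preimage_eq (μ : Measure V) [μ.IsAddHaarMeasure] [μ.Regular] (e : V ≃ₜ+ V) {Λ : Set V}
    (hΛ0 : μ Λ ≠ 0) (hΛ : μ Λ ≠ ∞) (he : e ⁻¹' Λ = Λ) {S : Set V} (hS : e ⁻¹' S = S) (g : V → ℂ) :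
    ∫ x in S, g (e x) ∂μ = ∫ x in S, g x ∂μ := by
  have h := (measurePreserving_of_preimage_eq μ e hΛ0 hΛ he).setIntegral_preimage_emb
    e.toHomeomorph.toMeasurableEquiv.measurableEmbedding g S
  rwa [hS] at h

end Lattice

end Summit.HodgeConjecture.HodgeConjecture.Cruxes.HLiu418.K2LiuShellVanishingByAveraging

end
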